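import Literature.IUT.HodgeTheaters.PuncturedEllipticCoveringsCor12Thm26
import Literature.AnabelianGeometry.AbsoluteAnabelian.AbsTopISemiAbsoluteProofs
import Literature.AnabelianGeometry.AbsoluteAnabelian.NFGaloisTFGNormalProofs
import HarnessLib

/-!
# [IUTchI] Cor. 1.2: the `Δ`-clause reduced to [AbsAnab] Lemma 1.1.4 (i) / [AbsTopI] Prop. 2.2 —
# `Δ_C` topologically finitely generated — via the tree's PROOF of [AbsAnab] Thm. 1.1.2 — proofs only

S. Mochizuki, *Inter-universal Teichmüller theory I*, kurims manuscript (May 2020), §1, Corollary 1.2,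
proof p. 39 ([IUTchI] Cor 1.2 p.39) [claim: Mochizuki2012, status: disputed]: "one may recover the
subgroup `Δ_{X̲→} ⊆ Π_{X̲→}` via the algorithms of [AbsTopI], Theorem 2.6, (v), (vi)".

`Proofs` companion (theorems only; no definitions, nothing restated) of abc-iut-L5-d4's
`PuncturedEllipticCoveringsCor12Thm26` (p437972), where the clause `Θ(Δ_C) = Δ'_C` of the typed
Cor. 1.2 was obtained from abc-iut-L4's typed [AbsTopI] Thm. 2.6 (vi) `FundamentalExtension.Thm26vi`
BY NAME at the two cores.  Only the SECOND conjunct of `Thm26vi` is used there — [AbsAnab] Lemma 1.1.4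
(i)'s conclusion `FundamentalExtension.GeomIsMaxTFGNormalIn ⊤` ("`Δ` is the unique maximal closed
normal subgroup of `Π` which is topologically finitely generated", FACT-LIST F-0005) — and for
extensions `1 → Δ → Π → G_F → 1` with `F` a number field and `Δ` topologically finitely generated
([AbsTopI] Prop. 2.2, `FundamentalExtension.GeomTFG`, F-0240) that conclusion is a KERNEL THEOREM of the
tree: abc-iut-L4-t4's `FundamentalExtension.thm26_vi_maximal_of_tfgNormalSubgroup_trivial` applied to the
PROVED [AbsAnab] Thm. 1.1.2 `galoisNF_tfgNormalSubgroup_trivial_holds` (F-0031, abc-iut-L4;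
`NFGaloisTFGNormalProofs.lean`).  Hence:

* `map_deltaC_eq_of_geomIsMaxTFGNormalIn` — `Θ(Δ_C) = Δ'_C` for every `Θ : Π_C ≃ₜ* Π'_C` from
  `GeomIsMaxTFGNormalIn ⊤` at both cores (abc-iut-L4-t6's `geom_map_eq_of_geomIsMaxTFGNormalIn`);
  `geomIsMaxTFGNormalIn_of_geomTFG` — at universe `0`, number-field base data `NFBase` and `GeomTFG`
  give `GeomIsMaxTFGNormalIn ⊤` UNCONDITIONALLY;
* `core_extension_of_geomIsMaxTFGNormalIn` / `characteristicNatureOfCoverings_of_geomIsMaxTFGNormalIn` —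
  the assembly of `…Cor12Thm26` with `Thm26vi` weakened to `GeomIsMaxTFGNormalIn ⊤`;
* `characteristicNatureOfCoverings_of_geomTFG` (universe `0`) and, at the `K`-level §1 datum of two
  initial Θ-data over number fields, `InitialThetaData.pe_characteristicNatureOfCoverings_of_geomTFG` —
  the typed Cor. 1.2 whose `Δ`-input is now ONLY: number-field base data `NFBase` for the two cores
  (data) and [AbsTopI] Prop. 2.2 `GeomTFG` at the two cores; remaining binders as in p437972
  (`ArrowCoveringClaims` ×2, `CuspGalois` ×2, ramification of `ε⁰` ×2 = GAP-LEDGER G-L5d4g6-1, `htf`,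
  `huniq'`, `hext`, `hextC`, `hLem45`, `hLem45C`).

HONEST FRAMING: binders are assumption labels; typed ≠ discharged for the anabelian inputs and for
`GeomTFG` (layer L4's node); nothing here takes a side on [IUTchIII] Cor. 3.12; no printed statement is
strengthened.
-/

namespace Literature.IUT.HodgeTheaters

namespace PuncturedEllipticData

open scoped Pointwise
open Literature.AnabelianGeometry.AbsoluteAnabelian
open Literature.AnabelianGeometry.AbsoluteAnabelian.AbsTopII (semiEllipticDoubleCoverSubgroups)

universe u

variable {D D' : PuncturedEllipticData.{u}}

/-! ### `Θ(Δ_C) = Δ'_C` from [AbsAnab] Lemma 1.1.4 (i)'s conclusion at both cores -/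

/-- `Θ(Δ_C) = Δ'_C` for EVERY isomorphism of topological groups `Θ : Π_C ⥲ Π'_C`, GIVEN that in both
cores `Δ` is the maximal topologically finitely generated closed normal subgroup of `Π`
(`GeomIsMaxTFGNormalIn ⊤`, [AbsAnab] Lemma 1.1.4 (i) / [AbsTopI] Thm. 2.6 (vi)) — abc-iut-L4-t6's
`geom_map_eq_of_geomIsMaxTFGNormalIn`. ([IUTchI] Cor 1.2 p.39) [claim: Mochizuki2012, status: disputed] -/
theorem map_deltaC_eq_of_geomIsMaxTFGNormalIn (h : D.E.GeomIsMaxTFGNormalIn ⊤)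
    (h' : D'.E.GeomIsMaxTFGNormalIn ⊤) (Θ : D.PiC ≃ₜ* D'.PiC) :
    D.DeltaC.map Θ.toMulEquiv.toMonoidHom = D'.DeltaC :=
  FundamentalExtension.geom_map_eq_of_geomIsMaxTFGNormalIn h h' Θ

/-- **At universe `0`, over a number field, `GeomIsMaxTFGNormalIn ⊤` is a THEOREM**: for a core
`Π_C ↠ G` with number-field base data (`NFBase`: `G ≅ G_F`) and `Δ_C` topologically finitely
generated ([AbsTopI] Prop. 2.2, `GeomTFG`), `Δ_C` is the maximal topologically finitely generated
closed normal subgroup of `Π_C` — abc-iut-L4-t4's `thm26_vi_maximal_of_tfgNormalSubgroup_trivial`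
applied to the tree's PROOF `galoisNF_tfgNormalSubgroup_trivial_holds` of [AbsAnab] Thm. 1.1.2.
([IUTchI] Cor 1.2 p.39) [claim: Mochizuki2012, status: disputed] -/
theorem geomIsMaxTFGNormalIn_of_geomTFG {D : PuncturedEllipticData.{0}} (B : D.E.NFBase)
    (hΔ : D.E.GeomTFG) : D.E.GeomIsMaxTFGNormalIn ⊤ :=
  FundamentalExtension.thm26_vi_maximal_of_tfgNormalSubgroup_trivial
    galoisNF_tfgNormalSubgroup_trivial_holds D.E B hΔ

/-! ### The composite `hcore` / `hcoreC` from the weakened input -/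

/-- The pair-level anabelian binder of `…Cor12Assembly` / `…Cor12Respd` DERIVED as in
`core_extension_of_thm26vi` (p437972), with [AbsTopI] Thm. 2.6 (vi) WEAKENED to its used conjunct
`GeomIsMaxTFGNormalIn ⊤` at both cores. ([IUTchI] Cor 1.2 p.39) [claim: Mochizuki2012, status:
disputed] -/
theorem core_extension_of_geomIsMaxTFGNormalIn {A : Subgroup D.PiC} {A' : Subgroup D'.PiC}
    (h : D.E.GeomIsMaxTFGNormalIn ⊤) (h' : D'.E.GeomIsMaxTFGNormalIn ⊤)
    (htf : IsMulTorsionFree ↥(D.PiX ⊓ D.DeltaC))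
    (huniq' : ∀ J ∈ semiEllipticDoubleCoverSubgroups D'.E, J ⊓ D'.DeltaC = D'.PiX ⊓ D'.DeltaC)
    (hext : ∀ φ : A ≃* A', Continuous φ → Continuous φ.symm →
      ∃ Θ : D.PiC ≃ₜ* D'.PiC, ∀ x : A, Θ (x : D.PiC) = (φ x : D'.PiC)) :
    ∀ φ : A ≃* A', Continuous φ → Continuous φ.symm →
      ∃ Θ : D.PiC ≃* D'.PiC, Continuous Θ ∧ Continuous Θ.symm ∧
        (∀ x : A, Θ (x : D.PiC) = (φ x : D'.PiC)) ∧
        (D.PiX ⊓ D.DeltaC).map Θ.toMonoidHom = D'.PiX ⊓ D'.DeltaC ∧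
        D.DeltaC.map Θ.toMonoidHom = D'.DeltaC := by
  intro φ hφ hφ'
  obtain ⟨Θ, hΘ⟩ := hext φ hφ hφ'
  have hΔ := map_deltaC_eq_of_geomIsMaxTFGNormalIn h h' Θ
  exact ⟨Θ.toMulEquiv, Θ.continuous, Θ.symm.continuous, hΘ,
    map_deltaX_eq_of_semiElliptic Θ hΔ htf huniq', hΔ⟩

/-! ### Corollary 1.2 assembled -/

/-- **Corollary 1.2 with the `Δ`-input `GeomIsMaxTFGNormalIn ⊤` at the two cores** ([AbsAnab] Lemma
1.1.4 (i)'s conclusion, F-0005, BY NAME), otherwise as `characteristicNatureOfCoverings_of_thm26vi`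
(p437972): binders `ArrowCoveringClaims` ×2, `CuspGalois` ×2, `[Π_X : Π_X̲] = l` ×2, ramification of
`ε⁰` ×2, `htf`, `huniq'`, `hext`, `hextC`, `hLem45`, `hLem45C`. ([IUTchI] Cor 1.2 p.39)
[claim: Mochizuki2012, status: disputed] -/
theorem characteristicNatureOfCoverings_of_geomIsMaxTFGNormalIn (h : D.ArrowCoveringClaims)
    (h' : D'.ArrowCoveringClaims) (C : D.CuspGalois) (C' : D'.CuspGalois)
    (hX : D.PiXbar.relIndex D.PiX = D.l) (hX' : D'.PiXbar.relIndex D'.PiX = D'.l)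
    (h0 : ¬ D.inertia D.ε0 ≤ D.piXarrow) (h0' : ¬ D'.inertia D'.ε0 ≤ D'.piXarrow)
    (h114 : D.E.GeomIsMaxTFGNormalIn ⊤) (h114' : D'.E.GeomIsMaxTFGNormalIn ⊤)
    (htf : IsMulTorsionFree ↥(D.PiX ⊓ D.DeltaC))
    (huniq' : ∀ J ∈ semiEllipticDoubleCoverSubgroups D'.E, J ⊓ D'.DeltaC = D'.PiX ⊓ D'.DeltaC)
    (hext : ∀ φ : D.piXarrow ≃* D'.piXarrow, Continuous φ → Continuous φ.symm →
      ∃ Θ : D.PiC ≃ₜ* D'.PiC, ∀ x : D.piXarrow, Θ (x : D.PiC) = (φ x : D'.PiC))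
    (hextC : ∀ ψ : D.piCarrow ≃* D'.piCarrow, Continuous ψ → Continuous ψ.symm →
      ∃ Θ : D.PiC ≃ₜ* D'.PiC, ∀ x : D.piCarrow, Θ (x : D.PiC) = (ψ x : D'.PiC))
    (hLem45 : ∀ Θ : D.PiC ≃* D'.PiC, Continuous Θ → Continuous Θ.symm →
      D.PiXbar.map Θ.toMonoidHom = D'.PiXbar →
        (∀ x : D.Cusp, ∃ x' : D'.Cusp, ∃ t' ∈ D'.PiXbar,
          (D.decomp x).map Θ.toMonoidHom = MulAut.conj t' • D'.decomp x') ∧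
        (∀ x' : D'.Cusp, ∃ x : D.Cusp, ∃ t' ∈ D'.PiXbar,
          (D.decomp x).map Θ.toMonoidHom = MulAut.conj t' • D'.decomp x'))
    (hLem45C : ∀ Θ : D.PiC ≃* D'.PiC, Continuous Θ → Continuous Θ.symm →
      D.PiCbar.map Θ.toMonoidHom = D'.PiCbar →
        (∀ x : D.Cusp, x ≠ D.ε0 → ∃ x' : D'.Cusp, x' ≠ D'.ε0 ∧ ∃ t' ∈ D'.PiCbar,
          (D.decomp x).map Θ.toMonoidHom = MulAut.conj t' • D'.decomp x') ∧
        (∀ x' : D'.Cusp, x' ≠ D'.ε0 → ∃ x : D.Cusp, x ≠ D.ε0 ∧ ∃ t' ∈ D'.PiCbar,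
          (D.decomp x).map Θ.toMonoidHom = MulAut.conj t' • D'.decomp x')) :
    D.CharacteristicNatureOfCoverings D' :=
  characteristicNatureOfCoverings_of_anabelian' h h' C C' hX hX' h0 h0'
    (core_extension_of_geomIsMaxTFGNormalIn h114 h114' htf huniq' hext) hLem45
    (core_extension_of_geomIsMaxTFGNormalIn h114 h114' htf huniq' hextC) hLem45C

/-- **Corollary 1.2 over number fields (universe `0`), the `Δ`-input reduced to [AbsTopI] Prop. 2.2**:
for data whose cores carry number-field base data `B`, `B'` (`G ≅ G_F`: the Cor. 1.2 hypothesis "`k`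
an NF") and have `Δ_C` topologically finitely generated (`GeomTFG`), the clause `Θ(Δ_C) = Δ'_C` holds
unconditionally (via the tree's proof of [AbsAnab] Thm. 1.1.2); remaining binders as in
`characteristicNatureOfCoverings_of_geomIsMaxTFGNormalIn`. ([IUTchI] Cor 1.2 p.39)
[claim: Mochizuki2012, status: disputed] -/
theorem characteristicNatureOfCoverings_of_geomTFG {D D' : PuncturedEllipticData.{0}}
    (h : D.ArrowCoveringClaims) (h' : D'.ArrowCoveringClaims) (C : D.CuspGalois) (C' : D'.CuspGalois)
    (hX : D.PiXbar.relIndex D.PiX = D.l) (hX' : D'.PiXbar.relIndex D'.PiX = D'.l)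
    (h0 : ¬ D.inertia D.ε0 ≤ D.piXarrow) (h0' : ¬ D'.inertia D'.ε0 ≤ D'.piXarrow)
    (B : D.E.NFBase) (B' : D'.E.NFBase) (hΔ : D.E.GeomTFG) (hΔ' : D'.E.GeomTFG)
    (htf : IsMulTorsionFree ↥(D.PiX ⊓ D.DeltaC))
    (huniq' : ∀ J ∈ semiEllipticDoubleCoverSubgroups D'.E, J ⊓ D'.DeltaC = D'.PiX ⊓ D'.DeltaC)
    (hext : ∀ φ : D.piXarrow ≃* D'.piXarrow, Continuous φ → Continuous φ.symm →
      ∃ Θ : D.PiC ≃ₜ* D'.PiC, ∀ x : D.piXarrow, Θ (x : D.PiC) = (φ x : D'.PiC))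
    (hextC : ∀ ψ : D.piCarrow ≃* D'.piCarrow, Continuous ψ → Continuous ψ.symm →
      ∃ Θ : D.PiC ≃ₜ* D'.PiC, ∀ x : D.piCarrow, Θ (x : D.PiC) = (ψ x : D'.PiC))
    (hLem45 : ∀ Θ : D.PiC ≃* D'.PiC, Continuous Θ → Continuous Θ.symm →
      D.PiXbar.map Θ.toMonoidHom = D'.PiXbar →
        (∀ x : D.Cusp, ∃ x' : D'.Cusp, ∃ t' ∈ D'.PiXbar,
          (D.decomp x).map Θ.toMonoidHom = MulAut.conj t' • D'.decomp x') ∧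
        (∀ x' : D'.Cusp, ∃ x : D.Cusp, ∃ t' ∈ D'.PiXbar,
          (D.decomp x).map Θ.toMonoidHom = MulAut.conj t' • D'.decomp x'))
    (hLem45C : ∀ Θ : D.PiC ≃* D'.PiC, Continuous Θ → Continuous Θ.symm →
      D.PiCbar.map Θ.toMonoidHom = D'.PiCbar →
        (∀ x : D.Cusp, x ≠ D.ε0 → ∃ x' : D'.Cusp, x' ≠ D'.ε0 ∧ ∃ t' ∈ D'.PiCbar,
          (D.decomp x).map Θ.toMonoidHom = MulAut.conj t' • D'.decomp x') ∧
        (∀ x' : D'.Cusp, x' ≠ D'.ε0 → ∃ x : D.Cusp, x ≠ D.ε0 ∧ ∃ t' ∈ D'.PiCbar,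
          (D.decomp x).map Θ.toMonoidHom = MulAut.conj t' • D'.decomp x')) :
    D.CharacteristicNatureOfCoverings D' :=
  characteristicNatureOfCoverings_of_geomIsMaxTFGNormalIn h h' C C' hX hX' h0 h0'
    (geomIsMaxTFGNormalIn_of_geomTFG B hΔ) (geomIsMaxTFGNormalIn_of_geomTFG B' hΔ') htf huniq' hext
    hextC hLem45 hLem45C

end PuncturedEllipticData

/-! ### At the `K`-level §1 datum of two initial Θ-data over number fields (universe `0`) -/

namespace InitialThetaData

open scoped Pointwise
open Literature.AnabelianGeometry.AbsoluteAnabelian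
open Literature.AnabelianGeometry.AbsoluteAnabelian.AbsTopII (semiEllipticDoubleCoverSubgroups)

universe u v u' v'

variable {F : Type u} {K : Type v} {Fbar : Type} [Field F] [NumberField F] [Field K] [NumberField K]
  [Algebra F K] [Field Fbar] [Algebra F Fbar] [Algebra K Fbar]
  {E : WeierstrassCurve F} [E.IsElliptic] {l : ℕ} {Pb : BadPlacePredicates K}
  (D : InitialThetaData F K Fbar E l Pb)
  {F' : Type u'} {K' : Type v'} [Field F'] [NumberField F'] [Field K'] [NumberField K'] [Algebra F' K']
  {Fbar' : Type} [Field Fbar'] [Algebra F' Fbar'] [Algebra K' Fbar']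
  {E' : WeierstrassCurve F'} [E'.IsElliptic] {l' : ℕ} {Pb' : BadPlacePredicates K'}
  (D' : InitialThetaData F' K' Fbar' E' l' Pb')

/-- **[IUTchI] Cor. 1.2 between the `K`-level data of two initial Θ-data, the `Δ`-clause reduced to
[AbsTopI] Prop. 2.2** (algebraic closures `F̄`, `F̄'` in universe `0`): GIVEN number-field base data for
the two cores `Π_{C_K} ↠ G_K`, `Π_{C_{K'}} ↠ G_{K'}` (`NFBase`: `G ≅ G_{F₀}` for number fields `F₀`,
`F₀'` — Def. 3.1: `K`, `K'` are number fields) and topological finite generation of `Δ_{C_K}`,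
`Δ_{C_{K'}}` ([AbsTopI] Prop. 2.2 `GeomTFG`, F-0240), the typed Cor. 1.2 follows from the remaining
binders of `pe_characteristicNatureOfCoverings_of_thm26vi` (p437972) — `Thm26vi` is NO LONGER an
input: its used conjunct is the tree's theorem over number fields ([AbsAnab] Thm. 1.1.2 PROVED,
`galoisNF_tfgNormalSubgroup_trivial_holds`).  The law `[Π_X : Π_X̲] = l` is Def. 3.1 (d).
([IUTchI] Cor 1.2 p.39) [claim: Mochizuki2012, status: disputed] -/
theorem pe_characteristicNatureOfCoverings_of_geomTFG (h : D.geom.pe.ArrowCoveringClaims)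
    (h' : D'.geom.pe.ArrowCoveringClaims) (C : D.geom.pe.CuspGalois) (C' : D'.geom.pe.CuspGalois)
    (h0 : ¬ D.geom.pe.inertia D.geom.pe.ε0 ≤ D.geom.pe.piXarrow)
    (h0' : ¬ D'.geom.pe.inertia D'.geom.pe.ε0 ≤ D'.geom.pe.piXarrow)
    (B : D.geom.pe.E.NFBase) (B' : D'.geom.pe.E.NFBase) (hΔ : D.geom.pe.E.GeomTFG)
    (hΔ' : D'.geom.pe.E.GeomTFG) (htf : IsMulTorsionFree ↥(D.geom.pe.PiX ⊓ D.geom.pe.DeltaC))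
    (huniq' : ∀ J ∈ semiEllipticDoubleCoverSubgroups D'.geom.pe.E,
      J ⊓ D'.geom.pe.DeltaC = D'.geom.pe.PiX ⊓ D'.geom.pe.DeltaC)
    (hext : ∀ φ : D.geom.pe.piXarrow ≃* D'.geom.pe.piXarrow, Continuous φ → Continuous φ.symm →
      ∃ Θ : D.geom.pe.PiC ≃ₜ* D'.geom.pe.PiC,
        ∀ x : D.geom.pe.piXarrow, Θ (x : D.geom.pe.PiC) = (φ x : D'.geom.pe.PiC))
    (hextC : ∀ ψ : D.geom.pe.piCarrow ≃* D'.geom.pe.piCarrow, Continuous ψ → Continuous ψ.symm →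
      ∃ Θ : D.geom.pe.PiC ≃ₜ* D'.geom.pe.PiC,
        ∀ x : D.geom.pe.piCarrow, Θ (x : D.geom.pe.PiC) = (ψ x : D'.geom.pe.PiC))
    (hLem45 : ∀ Θ : D.geom.pe.PiC ≃* D'.geom.pe.PiC, Continuous Θ → Continuous Θ.symm →
      D.geom.pe.PiXbar.map Θ.toMonoidHom = D'.geom.pe.PiXbar →
        (∀ x : D.geom.pe.Cusp, ∃ x' : D'.geom.pe.Cusp, ∃ t' ∈ D'.geom.pe.PiXbar,
          (D.geom.pe.decomp x).map Θ.toMonoidHom = MulAut.conj t' • D'.geom.pe.decomp x') ∧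
        (∀ x' : D'.geom.pe.Cusp, ∃ x : D.geom.pe.Cusp, ∃ t' ∈ D'.geom.pe.PiXbar,
          (D.geom.pe.decomp x).map Θ.toMonoidHom = MulAut.conj t' • D'.geom.pe.decomp x'))
    (hLem45C : ∀ Θ : D.geom.pe.PiC ≃* D'.geom.pe.PiC, Continuous Θ → Continuous Θ.symm →
      D.geom.pe.PiCbar.map Θ.toMonoidHom = D'.geom.pe.PiCbar →
        (∀ x : D.geom.pe.Cusp, x ≠ D.geom.pe.ε0 → ∃ x' : D'.geom.pe.Cusp, x' ≠ D'.geom.pe.ε0 ∧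
          ∃ t' ∈ D'.geom.pe.PiCbar,
            (D.geom.pe.decomp x).map Θ.toMonoidHom = MulAut.conj t' • D'.geom.pe.decomp x') ∧
        (∀ x' : D'.geom.pe.Cusp, x' ≠ D'.geom.pe.ε0 → ∃ x : D.geom.pe.Cusp, x ≠ D.geom.pe.ε0 ∧
          ∃ t' ∈ D'.geom.pe.PiCbar,
            (D.geom.pe.decomp x).map Θ.toMonoidHom = MulAut.conj t' • D'.geom.pe.decomp x')) :
    D.geom.pe.CharacteristicNatureOfCoverings D'.geom.pe :=
  PuncturedEllipticData.characteristicNatureOfCoverings_of_geomTFG h h' C C' D.pe_relIndex_piXbar_piX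
    D'.pe_relIndex_piXbar_piX h0 h0' B B' hΔ hΔ' htf huniq' hext hextC hLem45 hLem45C

end InitialThetaData

end Literature.IUT.HodgeTheaters
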